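import Summits.BirchSwinnertonDyer.Rank1Residual.Additive.KatoDescentGlobalKummerSaturationRows
import HarnessLib

set_option autoImplicit false

/-!
# THE INTEGRAL LATTICE IN RANK ONE: `H¹(ℤ[1/p], T_pW) = p^a · ℤ_p κ_∞(P)` EXACTLY, and `v₀ = a + v(log_ω P)` — potss (R1-a)
# «`𝔥 = p^a · ℤ_p κ(P)`» as printed (seat `bsd-cm-prr-ty1` g10, cell `bsd-cm`; theorems only: no definition, no named fact,
# no instance, no `sorry`)

Sequel of `KatoDescentGlobalKummerSaturation{,Rows}` (E10: every integral class is `ν • κ_∞(P)`) and of brick (a′)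
(`KatoDescentGlobalKummerTamagawa`: `p^c • κ_∞(P)` is integral).  On the rows of stub 3 (`W` globally minimal, `rank W(ℚ) = 1`
generated by `P` modulo torsion, `Ш[p^∞]` finite, `p ∤ #W(ℚ)_tors`), with `x = κ_∞(P)` the `T_p`-adic Kummer class:

* `exists_integralH1_eq_span_pow_smul` — **there is ONE exponent `a` with `integralH1 (tateRep W p) p ⊤ = ℤ_p ∙ (p^a • x)` and
  `p^j • x` integral `↔ a ≤ j`** (`a` = the least `j` with `p^j • κ_∞(P)` integral; `≤` the uniform `c` of brick (a′)).  A
  `ℤ_p`-submodule of the torsion-free cyclic module `ℤ_p κ_∞(P)` containing `p^c κ_∞(P)` is `p^a ℤ_p κ_∞(P)`: every `z ∈ A` is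
  `ν • x = u p^j • x` (E10), and `p^j • x = u⁻¹ • z ∈ A` forces `a ≤ j`.
* `exists_integralH1_eq_span_pow_smul_and_eq_add_valuation` — **and `v₀ = a + v(log_ω P)`** for the normalisation
  `φ(A) = p^{v₀} ℤ_p` of ANY Kummer-log functional `φ` on the bottom-layer copy `A = integralH1 … (κ.layerSubgroup 0)` of ANY
  `ℤ_p`-extension datum `κ`: `φ` of the class `z₀` over `p^a • x` is `p^a · log_ω P` and generates `φ(A)`.  So the display's `v₀` is
  the print exponent `a` of (R1-a) shifted by `v(log_ω P)` — independent of `φ` and `κ` — and COUNT-FINE⁰ reads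
  «`v_p #desc(I) + v_p #(X₀)_Γ − v_p #X₀^Γ + a = v_p #Ш[p^∞] + v_p Tam + v(log_ω P)`» with `p^a = [ℤ_p κ_∞(P) : 𝔥]`, the
  term that cancels against Poitou–Tate's `C′/p^a` in the print chain (potss memo (R1-d)/(R1-f)).

HONEST FRAMING: bookkeeping over tree theorems; no named fact, no definition; nothing about `𝐇²`, the fine Selmer group, the
Perrin-Riou formula or BSD is proved.  PARTITION: RANK axis × Kato–Perrin-Riou road (stub 3 of 19945/19223); closes no item.
References: [Kato2004Asterisque] §14.1, §14.18; [BlochKato1990] Ex. 3.11; [SerreLocalFields1979] II §3; [Rubin2000] App. B Prop. B.2.3.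
-/

noncomputable section

open scoped Classical NumberField ContRepresentation

open WeierstrassCurve Field IsDedekindDomain NumberField CategoryTheory Literature.NumberTheory.EllipticCurves
  Literature.NumberTheory.EllipticCurves.Kato2004 Literature.NumberTheory.GaloisRepresentations
  Literature.NumberTheory.EllipticCurves.Kato2004.EulerSystemValues
  Summit.BirchSwinnertonDyer.BirchSwinnertonDyer.Theorems.IntegralH1LayerZeroTop
open WeierstrassCurve (geomPoints geomTorsion galH1Torsion kummerMapTorsion)

universe u

namespace Summit.BirchSwinnertonDyer.Rank1Residual.Additive.GlobalKummer

variable (W : WeierstrassCurve ℚ) [W.IsElliptic] [W.IsGloballyMinimal] (p : ℕ) [Fact p.Prime]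
  [ContinuousSMul ℤ_[p] (W.tateModule p)]

/-! ## §1 `integralH1 (tateRep W p) p ⊤ = ℤ_p ∙ (p^a • κ_∞(P))` -/

/-- **THE INTEGRAL LATTICE: `H¹(ℤ[1/p], T_pW) = ℤ_p ∙ (p^a • κ_∞(P))` for ONE `a`, and `p^j • κ_∞(P)` is integral iff
`a ≤ j`** (rows: `W` globally minimal, rank `1` generated by `P` modulo torsion, `Ш[p^∞]` finite, `p ∤ #W(ℚ)_tors`; `x` with
`ofTop(red_{p^j} x) = κ_{p^j}(P)`).  `a` is the least exponent with `p^a • x` integral (it exists by brick (a′)); `⊇` is clear;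
`⊆`: `z ∈ A` is `ν • x` (E10 `exists_eq_smul_kummerTate_of_mem_integralH1`), `ν = u·p^j` with `u` a unit, and `p^j • x = u⁻¹ • z`
is integral, so `a ≤ j` and `z = (u p^{j−a}) • (p^a • x)`.  This is potss (R1-a) «`𝔥 = p^a · ℤ_p κ(P)`».
[cite: Kato2004Asterisque, §14.1 (p. 235) and §14.18 (p. 244)] [cite: SerreLocalFields1979, Ch. II §3] -/
theorem exists_integralH1_eq_span_pow_smul (hrank : W.mordellWeilRank = 1)
    (hsha : Finite (AddCommGroup.primaryComponent W.sha p)) (htors : ¬ p ∣ W.torsionOrder) {P : W.toAffine.Point}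
    (hgen : ∀ R : W.toAffine.Point, ∃ n : ℤ, IsOfFinAddOrder (R - n • P)) {x : H1 (tateRep W p) ⊤}
    (hx : ∀ j : ℕ,
      (ofTopSubgroup (W.torsionGaloisModule ((p : ℤ) ^ j)).toTopRep 1).hom (reduceH1Pk W p j ⊤ x) =
        kummerMapTorsion W ((p : ℤ) ^ j) (zsmul_pow_surjective W p j) P) :
    ∃ a : ℕ, integralH1 (tateRep W p) p ⊤ = ℤ_[p] ∙ (p ^ a • x) ∧
      ∀ j : ℕ, p ^ j • x ∈ integralH1 (tateRep W p) p ⊤ ↔ a ≤ j := by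
  have hp : p.Prime := Fact.out
  -- the least integral power
  obtain ⟨c, hc⟩ := exists_pow_smul_mem_integralH1_of_forall_eq W p (zsmul_pow_surjective W p)
  have hS : ∃ j : ℕ, p ^ j • x ∈ integralH1 (tateRep W p) p ⊤ := ⟨c, hc hx⟩
  set a : ℕ := Nat.find hS with ha
  have haS : p ^ a • x ∈ integralH1 (tateRep W p) p ⊤ := Nat.find_spec hS
  -- `p^j • x` integral for `a ≤ j`
  have hup : ∀ j : ℕ, a ≤ j → p ^ j • x ∈ integralH1 (tateRep W p) p ⊤ := by
    intro j hj
    rw [← Nat.sub_add_cancel hj, pow_add, mul_nsmul']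
    exact (integralH1 (tateRep W p) p ⊤).toAddSubgroup.nsmul_mem haS _
  have hiff : ∀ j : ℕ, p ^ j • x ∈ integralH1 (tateRep W p) p ⊤ ↔ a ≤ j :=
    fun j ↦ ⟨fun h ↦ Nat.find_min' hS h, hup j⟩
  refine ⟨a, le_antisymm ?_ ?_, hiff⟩
  · -- `⊆`: every integral class is `ν • x`, `ν = u p^j`, `a ≤ j`
    intro z hz
    obtain ⟨ν, rfl⟩ := exists_eq_smul_kummerTate_of_mem_integralH1 W p hrank hsha htors hgen hx hz
    by_cases hν : ν = 0
    · rw [hν, zero_smul]; exact Submodule.zero_mem _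
    set u : ℤ_[p]ˣ := PadicInt.unitCoeff hν with hu
    set j : ℕ := ν.valuation with hj
    have hνu : ν = (u : ℤ_[p]) * (p : ℤ_[p]) ^ j := PadicInt.unitCoeff_spec hν
    have hjx : p ^ j • x ∈ integralH1 (tateRep W p) p ⊤ := by
      have e : p ^ j • x = ((u⁻¹ : ℤ_[p]ˣ) : ℤ_[p]) • (ν • x) := by
        rw [hνu, smul_smul, ← mul_assoc, Units.inv_mul, one_mul, ← Nat.cast_pow, Nat.cast_smul_eq_nsmul]
      rw [e]
      exact (integralH1 (tateRep W p) p ⊤).smul_mem _ hz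
    have haj : a ≤ j := (hiff j).mp hjx
    refine Submodule.mem_span_singleton.mpr ⟨(u : ℤ_[p]) * (p : ℤ_[p]) ^ (j - a), ?_⟩
    rw [← Nat.cast_smul_eq_nsmul ℤ_[p] (p ^ a), smul_smul, Nat.cast_pow, mul_assoc, ← pow_add,
      Nat.sub_add_cancel haj, hνu]
  · -- `⊇`
    exact Submodule.span_le.mpr (Set.singleton_subset_iff.mpr haS)

/-! ## §2 `v₀ = a + v(log_ω P)` for every Kummer-log functional on the bottom layer -/

/-- **`v₀ = a + v(log_ω P)`**: on the rows, for ANY `ℤ_p`-extension datum `κ`, ANY Kummer-log functional `φ` on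
`A = integralH1 (tateRep W p) p (κ.layerSubgroup 0)` with `φ(A) = p^{v₀}ℤ_p`, and the exponent `a` of §1
(`integralH1 … ⊤ = ℤ_p ∙ (p^a • κ_∞(P))`): the class `z₀ ∈ A` over `p^a • κ_∞(P)` has `φ z₀ = p^a · log_ω P` (`HasLocPKummerLog` is
`ℤ_p`-linear and unique) and generates `A`, so `φ(A) = ℤ_p · p^a log_ω P`.  Hence the display's `v₀` is the print exponent of
(R1-a) shifted by `v(log_ω P)`, independent of `φ` and `κ`. [cite: Kato2004Asterisque, §14.18 (p. 244)] [cite: BlochKato1990, Ex. 3.11] -/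
theorem exists_integralH1_eq_span_pow_smul_and_eq_add_valuation (κ : ZpExtension ℚ p)
    (hrank : W.mordellWeilRank = 1) (hsha : Finite (AddCommGroup.primaryComponent W.sha p))
    (htors : ¬ p ∣ W.torsionOrder) {P : W.toAffine.Point}
    (hgen : ∀ R : W.toAffine.Point, ∃ n : ℤ, IsOfFinAddOrder (R - n • P)) {x : H1 (tateRep W p) ⊤}
    (hx : ∀ j : ℕ,
      (ofTopSubgroup (W.torsionGaloisModule ((p : ℤ) ^ j)).toTopRep 1).hom (reduceH1Pk W p j ⊤ x) =
        kummerMapTorsion W ((p : ℤ) ^ j) (zsmul_pow_surjective W p j) P)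
    (φ : integralH1 (tateRep W p) p (κ.layerSubgroup 0) →ₗ[ℤ_[p]] ℚ_[p])
    (hφ : ∀ z : integralH1 (tateRep W p) p (κ.layerSubgroup 0),
      HasLocPKummerLog W p (layerZeroToTop W p κ (z : H1 (tateRep W p) (κ.layerSubgroup 0))) (φ z))
    {v₀ : ℤ} (hv₀ : LinearMap.range φ = Submodule.span ℤ_[p] {((p : ℚ_[p]) ^ v₀)}) :
    ∃ a : ℕ, integralH1 (tateRep W p) p ⊤ = ℤ_[p] ∙ (p ^ a • x) ∧
      v₀ = (a : ℤ) + (padicLogLocal W p (Affine.Point.map (W' := W.toAffine) (S := ℚ) (Algebra.ofId ℚ ℚ_[p]) P)).valuation := by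
  have hp : p.Prime := Fact.out
  obtain ⟨a, hA, -⟩ := exists_integralH1_eq_span_pow_smul W p hrank hsha htors hgen hx
  refine ⟨a, hA, ?_⟩
  set t : ℚ_[p] := padicLogLocal W p (Affine.Point.map (W' := W.toAffine) (S := ℚ) (Algebra.ofId ℚ ℚ_[p]) P) with ht
  have hP : ¬ IsOfFinAddOrder P := ContraCount.not_isOfFinAddOrder_of_generates hrank hgen
  have ht0 : t ≠ 0 := LocPKummer.padicLogLocal_map_ne_zero W p hP
  have hp0 : (p : ℚ_[p]) ≠ 0 := Nat.cast_ne_zero.mpr hp.ne_zero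
  have hxlog : HasLocPKummerLog W p x t := hasLocPKummerLog_of_forall_eq W p (zsmul_pow_surjective W p) hx
  -- the bottom-layer class over `p^a • x`
  obtain ⟨e, he⟩ := exists_integralH1LayerZeroEquivTop W p κ
  have hax : p ^ a • x ∈ integralH1 (tateRep W p) p ⊤ := by
    rw [hA]; exact Submodule.mem_span_singleton_self _
  set z₀ : integralH1 (tateRep W p) p (κ.layerSubgroup 0) := e.symm ⟨p ^ a • x, hax⟩ with hz₀
  have hlz₀ : layerZeroToTop W p κ (z₀ : H1 (tateRep W p) (κ.layerSubgroup 0)) = p ^ a • x := by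
    rw [← he z₀, hz₀, LinearEquiv.apply_symm_apply]
  -- `φ z₀ = p^a · t`
  have hφz₀ : φ z₀ = (p : ℚ_[p]) ^ a * t := by
    have h := ContraCount.hasLocPKummerLog_smul_eq W p (c₁ := 1) (c₂ := (p : ℤ_[p]) ^ a)
      (x := layerZeroToTop W p κ (z₀ : H1 (tateRep W p) (κ.layerSubgroup 0))) (y := x)
      (by rw [one_smul, hlz₀, ← Nat.cast_pow, Nat.cast_smul_eq_nsmul]) (hφ z₀) hxlog
    simpa using h
  have hφz₀0 : φ z₀ ≠ 0 := by rw [hφz₀]; exact mul_ne_zero (pow_ne_zero _ hp0) ht0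
  have hval : (φ z₀).valuation = (a : ℤ) + t.valuation := by
    rw [hφz₀, Padic.valuation_mul (pow_ne_zero _ hp0) ht0, Padic.valuation_pow, Padic.valuation_p, mul_one]
  refine le_antisymm ?_ ?_
  · -- `v₀ ≤ v(φ z₀) = a + v(t)`
    rw [← hval]; exact LocPKummer.le_valuation_of_range_eq φ hv₀ hφz₀0
  · -- every `w ∈ A` lies over `ν • p^a • x`, so `φ w = ν p^a t` has valuation `≥ a + v(t)`; take `φ w = p^{v₀}`
    have hmem : ((p : ℚ_[p]) ^ v₀) ∈ LinearMap.range φ := by rw [hv₀]; exact Submodule.mem_span_singleton_self _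
    obtain ⟨w, hw⟩ := hmem
    have hwA : layerZeroToTop W p κ (w : H1 (tateRep W p) (κ.layerSubgroup 0)) ∈ ℤ_[p] ∙ (p ^ a • x) := by
      rw [← hA, ← he w]; exact (e w).2
    obtain ⟨ν, hν⟩ := Submodule.mem_span_singleton.mp hwA
    have hφw : φ w = (ν : ℚ_[p]) * ((p : ℚ_[p]) ^ a * t) := by
      have h := ContraCount.hasLocPKummerLog_smul_eq W p (c₁ := 1) (c₂ := ν * (p : ℤ_[p]) ^ a)
        (x := layerZeroToTop W p κ (w : H1 (tateRep W p) (κ.layerSubgroup 0))) (y := x)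
        (by rw [one_smul, ← hν, mul_smul, ← Nat.cast_pow, Nat.cast_smul_eq_nsmul]) (hφ w) hxlog
      simp only [PadicInt.coe_one, one_mul, PadicInt.coe_mul, PadicInt.coe_pow, PadicInt.coe_natCast] at h
      rw [h, mul_assoc]
    have hpv : ((p : ℚ_[p]) ^ v₀) ≠ 0 := zpow_ne_zero _ hp0
    have hν0 : (ν : ℚ_[p]) ≠ 0 := by
      intro h0; rw [h0, zero_mul, hw] at hφw; exact hpv hφw
    have h1 : v₀ = (ν : ℚ_[p]).valuation + ((a : ℤ) + t.valuation) := by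
      have h2 := congrArg Padic.valuation hφw
      rw [hw, Padic.valuation_zpow, Padic.valuation_p, mul_one,
        Padic.valuation_mul hν0 (mul_ne_zero (pow_ne_zero _ hp0) ht0),
        Padic.valuation_mul (pow_ne_zero _ hp0) ht0, Padic.valuation_pow, Padic.valuation_p, mul_one] at h2
      exact h2
    rw [h1]
    exact le_add_of_nonneg_left (PadicInt.valuation_coe_nonneg)

end Summit.BirchSwinnertonDyer.Rank1Residual.Additive.GlobalKummer
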